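import Summits.CriticalPhenomena.PercolationContinuityZ3.Theorems.PercNearOneGluingNoHeavyLowerTailHybridThreePointLBPointwise
import Literature.Probability.LatticeModels.SahiThirdOrderCorrelation
import Mathlib.Tactic.Ring
import Mathlib.Tactic.Linarith
import HarnessLib

/-!
# `NoHeavyLowerTail` (stmt-CriticalPhenomena-4575) — THEOREM (HYBRID / GROUP three-point lower bound): Sahi's `E₃ ≥ 0` for the
# triple `{P₁ ≁ c}, {c ≁ P₃}, {P₁ ≁ P₃′}` (`P₃ ⊆ P₃′`) on EVERY finite weighted graph, V: assembly and the theorem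

Support file (prover prim-cert-2 gen 9; `--supports stmt-CriticalPhenomena-4575`).  No named facts, no sorries.

**Theorem** (`sahiE3_hybrid_nonneg`; source of the proof: prim-ineq-gen-8, THEOREM-HYBRID-3PTLB.md, 2026-08-19 — lit-2's four-switching
proof of 3PT-LB with GROUP explorations and a small/large a-pole).  For Bernoulli bond percolation `prodBernoulli w` with arbitrary edge
weights on a finite vertex type, a vertex `c` and vertex sets `P₁`, `P₃ ⊆ P₃′`:
  `0 ≤ E₃({P₁ ≁ c}, {c ≁ P₃}, {P₁ ≁ P₃′})`
(Sahi's third-order functional `Literature.Probability.LatticeModels.sahiE3`; `{S ≁ T}` = no open path between the vertex sets).  No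
disjointness or non-emptiness hypotheses are needed.  Instances (all graphs): `P₁ = {b}, P₃ = P₃′ = {a}`: 3PT-LB = SHK3⁺
(`ThreePointLB.sahiE3_pairSep_nonneg`); `E1 = E₃({b≁c},{a≁c},{b≁{a,y}})` = four-point E3GRP class `(iii)` and its mirror `E2`; `DEC2`; class
`(b)` = `SEP3({a},{y},{b,c})`; the five-terminal E3GRP rows `r0 … r3` (file `…E3GroupSepHybridRows`).
Proof: `0 ≥ E[S]` (`cert_nonpos`, file IV) `= Σ products of PrW` (`sum_wt3W_cert`) `= −E₃` (eleven linear relations among the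
group-connection events, using only "`P₁ ~ c ~ P₃ ⊆ P₃′ ⇒ P₁ ~ P₃′`", and `hyb_identity` of file III): `hybrid_PrW` (finitary form), then
the bridge `prodBernoulli_real_eq_PrW_univ`.
-/

noncomputable section

namespace Summit.CriticalPhenomena.PercolationContinuityZ3.Theorems

namespace HybridThreePointLB

open Finset Literature.Probability.Percolation Literature.Probability.Percolation.DecisionTree
open Literature.Probability.Percolation.Gladkov ThreePointLB
open scoped Classical

variable {V : Type*} [Fintype V] [DecidableEq V]

/-! ### Splitting an event by a second one -/

omit [Fintype V] in
/-- `PrW E = PrW (E ∩ F) + PrW (E ∩ Fᶜ)`. [folklore] -/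
theorem PrW_split (D : Finset (Sym2 V)) (p : Sym2 V → ℝ) (E F : Set (Finset (Sym2 V))) :
    PrW D p E = PrW D p (E ∩ F) + PrW D p (E ∩ Fᶜ) := by
  rw [← PrW_union D p]
  · refine PrW_congr_set D p fun K _ => ?_
    simp only [Set.mem_union, Set.mem_inter_iff, Set.mem_compl_iff]
    tauto
  · exact Set.disjoint_left.2 fun K h1 h2 => h2.2 h1.2

/-! ### The theorem at the finitary level -/

section Main

variable {p : Sym2 V → ℝ} (hp0 : ∀ i, 0 ≤ p i) (hp1 : ∀ i, p i ≤ 1) (D : Finset (Sym2 V)) (c : V) (P₁ P₃ P₃' : Finset V)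
include hp0 hp1

/-- **Hybrid / group 3PT-LB at the finitary level**: for every finite vertex type, every coordinate set `D` with probabilities
`p ∈ [0,1]`, every vertex `c` and vertex sets `P₁`, `P₃ ⊆ P₃'`, with `A₁ = {P₁ ≁ c}`, `A₂ = {c ≁ P₃}`, `A₃ = {P₁ ≁ P₃'}`:
`0 ≤ 2 P(A₁A₂A₃) + P(A₁)P(A₂)P(A₃) − (P(A₁)P(A₂A₃) + P(A₂)P(A₁A₃) + P(A₃)P(A₁A₂))`.  Source: prim-ineq-gen-8, THEOREM-HYBRID-3PTLB.md.
[this work] -/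
theorem hybrid_PrW (hP : P₃ ⊆ P₃') :
    0 ≤ 2 * PrW D p ((gconn {c} P₁)ᶜ ∩ (gconn {c} P₃)ᶜ ∩ (gconn P₃' P₁)ᶜ)
        + PrW D p (gconn {c} P₁)ᶜ * PrW D p (gconn {c} P₃)ᶜ * PrW D p (gconn P₃' P₁)ᶜ
        - (PrW D p (gconn {c} P₁)ᶜ * PrW D p ((gconn {c} P₃)ᶜ ∩ (gconn P₃' P₁)ᶜ)
            + PrW D p (gconn {c} P₃)ᶜ * PrW D p ((gconn {c} P₁)ᶜ ∩ (gconn P₃' P₁)ᶜ)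
            + PrW D p (gconn P₃' P₁)ᶜ * PrW D p ((gconn {c} P₁)ᶜ ∩ (gconn {c} P₃)ᶜ)) := by
  -- the one transitivity fact: `P₁ ~ c`, `c ~ P₃ ⊆ P₃'` ⇒ `P₁ ~ P₃'`
  have T1 : ∀ K : Finset (Sym2 V), K ∈ gconn {c} P₁ → K ∈ gconn {c} P₃ → K ∈ gconn P₃' P₁ :=
    fun K h1 h3 => mem_gconn_trans_vertex h1 (mem_gconn_mono_right hP h3)
  -- identifications of reordered / redundant intersections (the seven atoms are the right-hand sides)
  have e_q : PrW D p ((gconn {c} P₁)ᶜ ∩ (gconn {c} P₃)ᶜ ∩ (gconn P₃' P₁)ᶜ) =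
      PrW D p ((gconn P₃' P₁)ᶜ ∩ ((gconn {c} P₁)ᶜ ∩ (gconn {c} P₃)ᶜ)) :=
    PrW_congr_set D p fun K _ => by simp only [Set.mem_inter_iff, Set.mem_compl_iff]; tauto
  have e_ua : PrW D p (gconn {c} P₁ ∩ (gconn {c} P₃)ᶜ ∩ (gconn P₃' P₁)ᶜ) = PrW D p (gconn {c} P₁ ∩ (gconn P₃' P₁)ᶜ) :=
    PrW_congr_set D p fun K _ => by
      simp only [Set.mem_inter_iff, Set.mem_compl_iff]; have := T1 K; tauto
  have e_ub : PrW D p ((gconn {c} P₁)ᶜ ∩ gconn {c} P₃ ∩ (gconn P₃' P₁)ᶜ) = PrW D p (gconn {c} P₃ ∩ (gconn P₃' P₁)ᶜ) :=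
    PrW_congr_set D p fun K _ => by
      simp only [Set.mem_inter_iff, Set.mem_compl_iff]; have := T1 K; tauto
  have e_ub' : PrW D p ((gconn P₃' P₁)ᶜ ∩ (gconn {c} P₁)ᶜ ∩ gconn {c} P₃) = PrW D p (gconn {c} P₃ ∩ (gconn P₃' P₁)ᶜ) :=
    PrW_congr_set D p fun K _ => by
      simp only [Set.mem_inter_iff, Set.mem_compl_iff]; have := T1 K; tauto
  have e_q' : PrW D p ((gconn P₃' P₁)ᶜ ∩ (gconn {c} P₁)ᶜ ∩ (gconn {c} P₃)ᶜ) =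
      PrW D p ((gconn P₃' P₁)ᶜ ∩ ((gconn {c} P₁)ᶜ ∩ (gconn {c} P₃)ᶜ)) :=
    PrW_congr_set D p fun K _ => by simp only [Set.mem_inter_iff, Set.mem_compl_iff]; tauto
  have e_ua' : PrW D p ((gconn {c} P₃)ᶜ ∩ (gconn P₃' P₁)ᶜ ∩ gconn {c} P₁) = PrW D p (gconn {c} P₁ ∩ (gconn P₃' P₁)ᶜ) :=
    PrW_congr_set D p fun K _ => by
      simp only [Set.mem_inter_iff, Set.mem_compl_iff]; have := T1 K; tauto
  have e_q'' : PrW D p ((gconn {c} P₃)ᶜ ∩ (gconn P₃' P₁)ᶜ ∩ (gconn {c} P₁)ᶜ) =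
      PrW D p ((gconn P₃' P₁)ᶜ ∩ ((gconn {c} P₁)ᶜ ∩ (gconn {c} P₃)ᶜ)) :=
    PrW_congr_set D p fun K _ => by simp only [Set.mem_inter_iff, Set.mem_compl_iff]; tauto
  have e_13 : PrW D p ((gconn {c} P₁)ᶜ ∩ (gconn P₃' P₁)ᶜ) = PrW D p ((gconn P₃' P₁)ᶜ ∩ (gconn {c} P₁)ᶜ) := by
    rw [Set.inter_comm]
  have e_31 : PrW D p ((gconn {c} P₃)ᶜ ∩ gconn {c} P₁) = PrW D p (gconn {c} P₁ ∩ (gconn {c} P₃)ᶜ) := by rw [Set.inter_comm]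
  have e_3c1c : PrW D p ((gconn {c} P₃)ᶜ ∩ (gconn {c} P₁)ᶜ) = PrW D p ((gconn {c} P₁)ᶜ ∩ (gconn {c} P₃)ᶜ) := by
    rw [Set.inter_comm]
  have e_G1 : PrW D p ((gconn P₃' P₁)ᶜ ∩ gconn {c} P₁) = PrW D p (gconn {c} P₁ ∩ (gconn P₃' P₁)ᶜ) := by rw [Set.inter_comm]
  -- the linear relations
  have R12 : PrW D p ((gconn {c} P₁)ᶜ ∩ (gconn {c} P₃)ᶜ) =
      PrW D p ((gconn {c} P₁)ᶜ ∩ (gconn {c} P₃)ᶜ ∩ gconn P₃' P₁) + PrW D p ((gconn P₃' P₁)ᶜ ∩ ((gconn {c} P₁)ᶜ ∩ (gconn {c} P₃)ᶜ)) := by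
    rw [PrW_split D p ((gconn {c} P₁)ᶜ ∩ (gconn {c} P₃)ᶜ) (gconn P₃' P₁), e_q]
  have RE1 : PrW D p (gconn {c} P₁ ∩ (gconn {c} P₃)ᶜ) =
      PrW D p (gconn {c} P₁ ∩ (gconn {c} P₃)ᶜ ∩ gconn P₃' P₁) + PrW D p (gconn {c} P₁ ∩ (gconn P₃' P₁)ᶜ) := by
    rw [PrW_split D p (gconn {c} P₁ ∩ (gconn {c} P₃)ᶜ) (gconn P₃' P₁), e_ua]
  have RE2 : PrW D p ((gconn {c} P₁)ᶜ ∩ gconn {c} P₃) =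
      PrW D p ((gconn {c} P₁)ᶜ ∩ gconn {c} P₃ ∩ gconn P₃' P₁) + PrW D p (gconn {c} P₃ ∩ (gconn P₃' P₁)ᶜ) := by
    rw [PrW_split D p ((gconn {c} P₁)ᶜ ∩ gconn {c} P₃) (gconn P₃' P₁), e_ub]
  have RG1 : PrW D p (gconn {c} P₁) = PrW D p (gconn {c} P₁ ∩ gconn {c} P₃) +
      (PrW D p (gconn {c} P₁ ∩ (gconn {c} P₃)ᶜ ∩ gconn P₃' P₁) + PrW D p (gconn {c} P₁ ∩ (gconn P₃' P₁)ᶜ)) := by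
    rw [PrW_split D p (gconn {c} P₁) (gconn {c} P₃), RE1]
  have RG3 : PrW D p (gconn {c} P₃) = PrW D p (gconn {c} P₁ ∩ gconn {c} P₃) +
      (PrW D p ((gconn {c} P₁)ᶜ ∩ gconn {c} P₃ ∩ gconn P₃' P₁) + PrW D p (gconn {c} P₃ ∩ (gconn P₃' P₁)ᶜ)) := by
    rw [PrW_split D p (gconn {c} P₃) (gconn {c} P₁), Set.inter_comm (gconn {c} P₃) (gconn {c} P₁),
      Set.inter_comm (gconn {c} P₃) (gconn {c} P₁)ᶜ, RE2]
  have RA1 : PrW D p (gconn {c} P₁)ᶜ =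
      (PrW D p ((gconn {c} P₁)ᶜ ∩ gconn {c} P₃ ∩ gconn P₃' P₁) + PrW D p (gconn {c} P₃ ∩ (gconn P₃' P₁)ᶜ)) +
        (PrW D p ((gconn {c} P₁)ᶜ ∩ (gconn {c} P₃)ᶜ ∩ gconn P₃' P₁) +
          PrW D p ((gconn P₃' P₁)ᶜ ∩ ((gconn {c} P₁)ᶜ ∩ (gconn {c} P₃)ᶜ))) := by
    rw [PrW_split D p (gconn {c} P₁)ᶜ (gconn {c} P₃), RE2, R12]
  have RA2 : PrW D p (gconn {c} P₃)ᶜ =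
      (PrW D p (gconn {c} P₁ ∩ (gconn {c} P₃)ᶜ ∩ gconn P₃' P₁) + PrW D p (gconn {c} P₁ ∩ (gconn P₃' P₁)ᶜ)) +
        (PrW D p ((gconn {c} P₁)ᶜ ∩ (gconn {c} P₃)ᶜ ∩ gconn P₃' P₁) +
          PrW D p ((gconn P₃' P₁)ᶜ ∩ ((gconn {c} P₁)ᶜ ∩ (gconn {c} P₃)ᶜ))) := by
    rw [PrW_split D p (gconn {c} P₃)ᶜ (gconn {c} P₁), e_31, e_3c1c, RE1, R12]
  have R13 : PrW D p ((gconn P₃' P₁)ᶜ ∩ (gconn {c} P₁)ᶜ) =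
      PrW D p (gconn {c} P₃ ∩ (gconn P₃' P₁)ᶜ) + PrW D p ((gconn P₃' P₁)ᶜ ∩ ((gconn {c} P₁)ᶜ ∩ (gconn {c} P₃)ᶜ)) := by
    rw [PrW_split D p ((gconn P₃' P₁)ᶜ ∩ (gconn {c} P₁)ᶜ) (gconn {c} P₃), e_ub', e_q']
  have RA3 : PrW D p (gconn P₃' P₁)ᶜ = PrW D p (gconn {c} P₁ ∩ (gconn P₃' P₁)ᶜ) +
      (PrW D p (gconn {c} P₃ ∩ (gconn P₃' P₁)ᶜ) + PrW D p ((gconn P₃' P₁)ᶜ ∩ ((gconn {c} P₁)ᶜ ∩ (gconn {c} P₃)ᶜ))) := by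
    rw [PrW_split D p (gconn P₃' P₁)ᶜ (gconn {c} P₁), e_G1, R13]
  have R23 : PrW D p ((gconn {c} P₃)ᶜ ∩ (gconn P₃' P₁)ᶜ) =
      PrW D p (gconn {c} P₁ ∩ (gconn P₃' P₁)ᶜ) + PrW D p ((gconn P₃' P₁)ᶜ ∩ ((gconn {c} P₁)ᶜ ∩ (gconn {c} P₃)ᶜ)) := by
    rw [PrW_split D p ((gconn {c} P₃)ᶜ ∩ (gconn P₃' P₁)ᶜ) (gconn {c} P₁), e_ua', e_q'']
  have hU : PrW D p (Set.univ : Set (Finset (Sym2 V))) = 1 := PrW_univ D p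
  have hsum : PrW D p (gconn {c} P₁) + PrW D p (gconn {c} P₁)ᶜ = 1 := by
    rw [← hU, PrW_split D p Set.univ (gconn {c} P₁), Set.univ_inter, Set.univ_inter]
  -- `E[S] ≤ 0`
  have hle : ∑ x ∈ triples D, wt3W D p x * cert c P₁ P₃ P₃' x ≤ 0 :=
    Finset.sum_nonpos fun x _ => mul_nonpos_of_nonneg_of_nonpos (DTree3.wt3W_nonneg D hp0 hp1 x) (cert_nonpos c P₁ P₃ P₃' hP x)
  rw [sum_wt3W_cert, hU, RG1, RG3, RA1, RA2, R12, R13] at hle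
  rw [RG1, RA1] at hsum
  rw [e_q, e_13, RA1, RA2, RA3, R23, R13, R12]
  have hid := hyb_identity (PrW D p ((gconn P₃' P₁)ᶜ ∩ ((gconn {c} P₁)ᶜ ∩ (gconn {c} P₃)ᶜ)))
    (PrW D p (gconn {c} P₁ ∩ (gconn P₃' P₁)ᶜ)) (PrW D p (gconn {c} P₃ ∩ (gconn P₃' P₁)ᶜ))
    (PrW D p ((gconn {c} P₁)ᶜ ∩ (gconn {c} P₃)ᶜ ∩ gconn P₃' P₁)) (PrW D p (gconn {c} P₁ ∩ gconn {c} P₃))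
    (PrW D p (gconn {c} P₁ ∩ (gconn {c} P₃)ᶜ ∩ gconn P₃' P₁)) (PrW D p ((gconn {c} P₁)ᶜ ∩ gconn {c} P₃ ∩ gconn P₃' P₁)) (by linarith)
  linarith

end Main

end HybridThreePointLB

/-! ### The theorem for `prodBernoulli w` (stated for `[Finite V]`, outside the explicit `[Fintype V] [DecidableEq V]` scope) -/

namespace HybridThreePointLB

section Measure

open Finset Literature.Probability.Percolation Literature.Probability.Percolation.DecisionTree
open Literature.Probability.Percolation.Gladkov ThreePointLB
open MeasureTheory Literature.Probability.LatticeModels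
open scoped Classical

variable {V : Type*} [Finite V]

/-- **THEOREM (hybrid / group 3PT-LB; Sahi's `C₃` for `{P₁ ≁ c}, {c ≁ P₃}, {P₁ ≁ P₃′}`), every finite weighted graph.**
For Bernoulli bond percolation `prodBernoulli w` with arbitrary edge weights `w : Sym2 V → [0,1]` on a finite vertex type `V`, a vertex `c`
and vertex sets `P₁`, `P₃ ⊆ P₃'`:
`0 ≤ E₃({P₁ ≁ c}, {c ≁ P₃}, {P₁ ≁ P₃'}) = 2μ(A₁A₂A₃) + μ(A₁)μ(A₂)μ(A₃) − μ(A₁)μ(A₂A₃) − μ(A₂)μ(A₁A₃) − μ(A₃)μ(A₁A₂)`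
(Sahi's functional `Literature.Probability.LatticeModels.sahiE3` on three decreasing GROUP-separation events; the instance of
[Kahn2022, Conj. 5] / Sahi's `C₃` for this family).  Source of the proof: prim-ineq-gen-8, THEOREM-HYBRID-3PTLB.md (2026-08-19); this
file is its formalisation.  Covers 3PT-LB (`P₁={b}, P₃=P₃'={a}`), E1/(iii), E2, DEC2, class (b), rows r0–r3 (file `…E3GroupSepHybridRows`). [this work] -/
theorem sahiE3_hybrid_nonneg (w : Sym2 V → unitInterval) (c : V) (P₁ P₃ P₃' : Finset V) (hP : P₃ ⊆ P₃') :
    0 ≤ sahiE3 (prodBernoulli w) {ω : BondConfig V | ∀ u ∈ P₁, ω ∉ openConn c u} {ω | ∀ v ∈ P₃, ω ∉ openConn c v}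
        {ω | ∀ v ∈ P₃', ∀ u ∈ P₁, ω ∉ openConn v u} := by
  obtain ⟨_instV⟩ := nonempty_fintype V
  have hp0 : ∀ e, 0 ≤ (w e : ℝ) := fun e => (w e).2.1
  have hp1 : ∀ e, (w e : ℝ) ≤ 1 := fun e => (w e).2.2
  have key := hybrid_PrW (p := fun e => (w e : ℝ)) hp0 hp1 Finset.univ c P₁ P₃ P₃' hP
  have hco : ∀ (S : Finset (Sym2 V)) (u v : V),
      (↑S : Set (Sym2 V)) ∈ openConn u v ↔ (openGraph (↑S : Set (Sym2 V))).Reachable u v := fun _ _ _ => Iff.rfl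
  have m1 : ∀ S : Finset (Sym2 V), S ∈ (gconn {c} P₁)ᶜ ↔ (↑S : Set (Sym2 V)) ∈ {ω : BondConfig V | ∀ u ∈ P₁, ω ∉ openConn c u} := by
    intro S
    simp only [Set.mem_compl_iff, mem_gconn, Finset.mem_singleton, Set.mem_setOf_eq, mem_cl, hco, not_exists, not_and]
    constructor
    · intro h u hu; exact h c rfl u hu
    · intro h s hs u hu; subst hs; exact h u hu
  have m2 : ∀ S : Finset (Sym2 V), S ∈ (gconn {c} P₃)ᶜ ↔ (↑S : Set (Sym2 V)) ∈ {ω : BondConfig V | ∀ v ∈ P₃, ω ∉ openConn c v} := by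
    intro S
    simp only [Set.mem_compl_iff, mem_gconn, Finset.mem_singleton, Set.mem_setOf_eq, mem_cl, hco, not_exists, not_and]
    constructor
    · intro h u hu; exact h c rfl u hu
    · intro h s hs u hu; subst hs; exact h u hu
  have m3 : ∀ S : Finset (Sym2 V), S ∈ (gconn P₃' P₁)ᶜ ↔
      (↑S : Set (Sym2 V)) ∈ {ω : BondConfig V | ∀ v ∈ P₃', ∀ u ∈ P₁, ω ∉ openConn v u} := by
    intro S
    simp only [Set.mem_compl_iff, mem_gconn, Set.mem_setOf_eq, mem_cl, hco, not_exists, not_and]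
  have e123 : (prodBernoulli w).real ({ω : BondConfig V | ∀ u ∈ P₁, ω ∉ openConn c u} ∩ {ω | ∀ v ∈ P₃, ω ∉ openConn c v} ∩
        {ω | ∀ v ∈ P₃', ∀ u ∈ P₁, ω ∉ openConn v u}) =
      PrW Finset.univ (fun e => (w e : ℝ)) ((gconn {c} P₁)ᶜ ∩ (gconn {c} P₃)ᶜ ∩ (gconn P₃' P₁)ᶜ) :=
    prodBernoulli_real_eq_PrW_univ w fun S => by rw [Set.mem_inter_iff, Set.mem_inter_iff, Set.mem_inter_iff, Set.mem_inter_iff, m1, m2, m3]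
  have e1 : (prodBernoulli w).real {ω : BondConfig V | ∀ u ∈ P₁, ω ∉ openConn c u} =
      PrW Finset.univ (fun e => (w e : ℝ)) (gconn {c} P₁)ᶜ := prodBernoulli_real_eq_PrW_univ w fun S => m1 S
  have e2 : (prodBernoulli w).real {ω : BondConfig V | ∀ v ∈ P₃, ω ∉ openConn c v} =
      PrW Finset.univ (fun e => (w e : ℝ)) (gconn {c} P₃)ᶜ := prodBernoulli_real_eq_PrW_univ w fun S => m2 S
  have e3 : (prodBernoulli w).real {ω : BondConfig V | ∀ v ∈ P₃', ∀ u ∈ P₁, ω ∉ openConn v u} =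
      PrW Finset.univ (fun e => (w e : ℝ)) (gconn P₃' P₁)ᶜ := prodBernoulli_real_eq_PrW_univ w fun S => m3 S
  have e23 : (prodBernoulli w).real ({ω : BondConfig V | ∀ v ∈ P₃, ω ∉ openConn c v} ∩ {ω | ∀ v ∈ P₃', ∀ u ∈ P₁, ω ∉ openConn v u}) =
      PrW Finset.univ (fun e => (w e : ℝ)) ((gconn {c} P₃)ᶜ ∩ (gconn P₃' P₁)ᶜ) :=
    prodBernoulli_real_eq_PrW_univ w fun S => by rw [Set.mem_inter_iff, Set.mem_inter_iff, m2, m3]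
  have e13 : (prodBernoulli w).real ({ω : BondConfig V | ∀ u ∈ P₁, ω ∉ openConn c u} ∩ {ω | ∀ v ∈ P₃', ∀ u ∈ P₁, ω ∉ openConn v u}) =
      PrW Finset.univ (fun e => (w e : ℝ)) ((gconn {c} P₁)ᶜ ∩ (gconn P₃' P₁)ᶜ) :=
    prodBernoulli_real_eq_PrW_univ w fun S => by rw [Set.mem_inter_iff, Set.mem_inter_iff, m1, m3]
  have e12 : (prodBernoulli w).real ({ω : BondConfig V | ∀ u ∈ P₁, ω ∉ openConn c u} ∩ {ω | ∀ v ∈ P₃, ω ∉ openConn c v}) =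
      PrW Finset.univ (fun e => (w e : ℝ)) ((gconn {c} P₁)ᶜ ∩ (gconn {c} P₃)ᶜ) :=
    prodBernoulli_real_eq_PrW_univ w fun S => by rw [Set.mem_inter_iff, Set.mem_inter_iff, m1, m2]
  rw [sahiE3_def, e123, e1, e2, e3, e23, e13, e12]
  exact key

end Measure

end HybridThreePointLB

end Summit.CriticalPhenomena.PercolationContinuityZ3.Theorems

end
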